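import Summits.Langlands.Langlands.Theorems.ArithmeticDialSplitHeart
import Summits.Langlands.Langlands.Theorems.TorusPricingSplit

/-!
# ArithmeticDialSplit — lens-4 g37 node (decomp-langlands, RESIDUAL MODE, route freeze: typed-not-filed)

**The α-axis of g36's dial is CLOSED on the regular sector; the residual is CORNERED to irregular `π∞` or mixed-signature `K`.**

TARGET BY NAME: TOR_res = `Summit.Langlands.Langlands.Theorems.TorusPricingSplit.TorusUncertifiedDihedralDescent` (tree `Theorems/TorusPricingSplit.lean`
p835153, def text sha12 `4660359b645a`, asserted by `gen_node37.py`) — lens-4 g36's DECLARED RESIDUAL of the dihedral cell: LOCK_res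
(`DeterminantLockSplit.LockUncertifiedDihedralDescent`, 8d3da6bf7036) ⊂ DCD_res (`PhaseMomentSplit`, 3eca34dd3340) ⊂ DCD (`AdjointCellSplit`, 60bc1c15c333) ⊂ IMP
(`PhaseTwistSplit.ImprimitiveCandidateRigidity`) ⊂ RIGID = stmt-Langlands-27355 `Theses.PerfectLayerClifford.PerfectLayerRigidity` (route-Langlands-PerfectLayerClifford, OPEN).
TOR_res = the configurations (`π` L-algebraic cuspidal on `GL₂/K`, `L/K` Galois with PERFECT group — no cyclic prime Galois subextension —, relative avatar `r` of `π_L`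
irreducible, dihedral candidate `ρ₀` over `K`) on which ALL THREE group dials are silent (`¬ PhaseMomentCertificate`, `¬ LockedPhaseMomentCertificate`) or the g36 dial
`(π L-arithmetic) ∧ TorusPhaseCertificate (Gal(L/K))` fails, GIVEN strong Artin over `K`.  g36 recorded its darkness as (α) `π` not known L-arithmetic («irregular
L-algebraic π of Maaß type … KNOWN for regular π: Clozel 3.13 + the Buzzard–Gee twist, PRINT — the tree has no `|det|^s` twist with its Satake dictionary») and
(β) torus-silent layer groups.

## The node (lens 4 = extremal / cornering: push the assumed counterexample into the corner the known theorems do not reach, and PROVE the walls)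

TOR_res ⟸ **RACC** ∧ **RTOR** ∧ **TOR_res′** — kernel `closes_target : RegularAccessibleAvatar → RegularTorusDihedralDescent → IrregularUncertifiedDihedralDescent →
TorusPricingSplit.TorusUncertifiedDihedralDescent` (0 sorry, NO named fact; cases on the corner predicate `regular ∧ (K totally real/CM ∨ TorusPhaseCertificate)`), with
the two walls DECIDED IN THE KERNEL modulo named Literature facts:

* **WALL 1 (α-axis, the new theorem — module 1 `Theorems/ArithmeticDialSplitHeart.lean`).**  `isLArithmetic_of_isLAlgebraic_of_isRegular (hC : Clozel1990_cArithmetic)`: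
  a REGULAR L-algebraic cuspidal `π` on `GL_n(𝔸_K)`, `K` ANY number field, `n ≥ 1`, is Buzzard–Gee L-ARITHMETIC — the δ-unfolding of the tree's
  `AutomorphicRepData.IsLArithmetic` VERBATIM (the antecedent g36 inlined into TOR° / TOR_res).  g36's flag «print: no twist in the tree» was too pessimistic: the
  tree's `exists_twist_isRegularAlgebraic_of_isLAlgebraic_of_isRegular` + `HasSatakeParamAt.of_map_mulChar_detTwist_of_cpow` (route IrreducibilityBySelfDuality,
  regular-sector file) give the regular algebraic twist `πt = π ⊗ |det|^{(n−1)/2}` with Satake parameter `q^{−(n−1)/2} α`; Clozel's fact gives ONE number field `E`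
  holding the `t_{v,i}(πt) = q^{i(n−i)/2} e_i(q^{−(n−1)/2} α)`; the PARITY IDENTITY `i(n−1) = i(n−i) + i(i−1)` turns this into `e_i(α) = q^{i(i−1)/2} · t_{v,i} ∈ E` with an
  INTEGER power of `q` (no `√q`, every parity of `n`), and Vieta finishes.  Hence `rtor_of_tor0 (hC) : TOR° → RTOR`: g36's certified, strong-Artin-free piece FIRES on
  every regular `π`, over every `K` — including the mixed-signature fields where no Galois representation of `π` is known.  (Reusable: the regular rungs of the cruxes
  `Theses.HeckeFieldDeRham.LArithmeticity` stmt-Langlands-17409, `Theses.TranscendenceCarving.LArithmeticity`, and the L-arithmeticity half of lens-3's INT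
  `Theses.DeterminantTowerSplit.IntegralFrobeniusData` all quote Clozel 3.13 «known one sector up» without a tree proof.)
* **WALL 2 (accessible-regular sector — RACC, decided modulo lang.S27).**  `racc_of_h27 (h27 : exists_galoisRep_of_regularAlgebraic) : RegularAccessibleAvatar`: over a
  totally real or CM `K` a regular L-algebraic `π` on `GL₂` HAS a semisimple avatar compatible a.e. (tree `exists_galoisRep_of_isLAlgebraic_of_isRegular`, made cofinite
  keeping semisimplicity) — so on this sector EVERY layer group, silent or not, is moot: the conclusion of TOR_res holds with the candidate, the three certificates and
  strong Artin unused.  RACC is the `n = 2` regular slice of the root piece Acc (`RootDecomp1.AccessibleAvatars`, 29148) in lang.S27's `IsTotallyReal ∨ IsCMField` form;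
  it is typed as a piece only to keep the kernel fact-free and is credited to nobody.
* **THE CORNER (TOR_res′ = `IrregularUncertifiedDihedralDescent`, declared residual).**  TOR_res's text VERBATIM plus the one antecedent
  `¬ (regular ∧ (K totally real/CM ∨ TorusPhaseCertificate (L ≃ₐ[K] L)))`.  What a counterexample to TOR_res must now look like: EITHER (α′) `π∞` is IRREGULAR at some
  archimedean place (`T.a σ` a repeated pair: Maaß type, or holomorphic limit of discrete series = weight one — the infinity TYPE does not separate them), on a lock-
  and adjoint-cell-silent perfect layer, over any `K`; OR (β′) `π` is regular, `K` has MIXED SIGNATURE (neither totally real nor CM: no Shimura variety, lang.S27 and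
  every potential-automorphy theorem silent) AND `Gal(L/K)` is torus-silent (and lock- and PMC-silent): `6·A₆` (2160), `SL₂(𝔽₁₃)`, `SL₂(𝔽₁₇)`, `2·A₇`, `SL₂(𝔽₁₉)`, … (instrument
  I-g36.1).  `closes_target_of_facts (h27) (hC) : TOR° → TOR_res′ → TOR_res`: modulo the two named facts, g36's piece and the corner recover g36's residual — THE
  RESIDUAL OF THE LINEAGE IS NOW TOR_res′ (`torres'_of_torres`: it is weaker; probes 3, 7, 23: it is not cheaply equivalent).

Edges: necessity `torres'_of_torres/_of_lockres/_of_imp/_of_rigid`, `rtor_of_imp/_of_rigid`, private `racc_of_langlands` (straight from the ROOT: reciprocity's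
irreducible `ρ` is semisimple), `rtor_of_langlands`, `torres'_of_langlands`; `pieces_of_imp`; host edges BY NAME through the tree kernels g36 → g35 → g34 → g33 → g30:
`closes_lockres`, `closes_dcd`, `closes_item` / `closes_item_of_facts` (→ stmt-Langlands-27355), `closes_route` (→ 28225 `GaloisHullLift.PerfectHullDescent`).

## Honest flags

1. RACC and WALL 1 are theorems MODULO NAMED FACTS (lang.S27 = Harris–Lan–Taylor–Thorne/Scholze/Varma, `exists_galoisRep_of_regularAlgebraic`; Clozel 1990 Thm. 3.13,
   `Clozel1990_cArithmetic` — both long-standing `Literature` facts consumed elsewhere in the tree as hypotheses; probes 28–29: neither is a tree theorem for `n = 2`).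
   RTOR itself is exactly as open as TOR° (g36 flag 1: the Lean debt of (a‴)); this node adds NO new open mechanism — it is a CORNERING node: two proved walls, one
   smaller residual.  Count-neutral by design.
2. The accessible-regular cut imports a decided sector of ANOTHER lineage (root piece Acc, regular part).  It is bookkeeping for the census DAG, stated openly; the new
   mathematics of g37 is WALL 1.
3. The corner (α′) is where Buzzard–Gee's Conjecture 3.1.5 (`lArithmetic_of_lAlgebraic`, tree-named, OPEN) and the torus/lock/adjoint-cell certificates would have to
   meet: for irregular `π` NOTHING in print gives L-arithmeticity (weight-one / partial-weight-one HOLOMORPHIC Hilbert forms are L-arithmetic by the q-expansion principle,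
   but `HasInfinityType` cannot see holomorphy; typing «holomorphic limit of discrete series» is a definition request, not made under the freeze).
4. Instrument note I-g37.S (kit `lp/advlp.py`, exact rational LP, seconds): for the order statistics of `SL₂(𝔽₁₃)` (the smallest torus-silent group after `6·A₆`) NO
   GALOIS-SYMMETRIC adversary phase law exists for ANY of the three dials (PMC / LPMC / TPC infeasible over class functions of `(d, e)`, `e ∣ d`), while the census's
   real LP (I-g36.1) finds asymmetric ones: every phase law a counterexample on an `SL₂(𝔽₁₃)`-layer must DISTINGUISH Galois-conjugate roots of unity.  (Same script:
   `A₅` certified by all three dials, `SL₂(𝔽₅)` PMC/LPMC-certified and TPC-silent via the symmetric law «ζ_g uniform on primitive `ord g`-th roots» — consistent with g34–g36.)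
   Recorded as structure of the near-counterexample, not as a lever: Satake phase laws need not be Galois-symmetric.
5. No kernel certificate for a silent group is added (the census addendum I-g33.1 asks for `6·A₆` / `SL₂(𝔽₁₃)` statistics from GAP; kit_allowed = false this seat).

## Barriers (bc8) and ceiling (bc9)

- technique_class: arithmeticity-of-automorphic-forms (Clozel purity/rationality via cohomology of arithmetic groups) + potential automorphy (lang.S27) — as INPUTS, named.
- `Literature.Barriers.Langlands.*` (endoscopic/CAP non-tempered packets, Ramanujan-type bounds, residual irreducibility hypotheses of R = T): WALL 1 sits OUTSIDE all of
  them — it is a statement about Hecke FIELDS, not sizes, and uses no automorphy lifting; WALL 2 inherits lang.S27's published hypotheses verbatim (regular, TR/CM) and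
  claims nothing beyond them; the corner is declared residual [no hits for "L-arithmetic irregular" / "Maass form Hecke field number field" as theorems in corpus(fts+vec)
  and galaxy beyond Buzzard–Gee's conjecture itself: corpus:paper:arxiv-1009.0785 p.13–14].
- bc9: method_family = Clozel-arithmeticity + HLTT/Scholze; ladder_ceiling = capped-at-«regular π∞» (Clozel 3.13 needs cohomological = regular; lang.S27 needs regular and
  TR/CM) [corpus:paper:arxiv-1009.0785 §3.1–3.2; Literature `ClozelCArithmetic.lean`, `ReciprocityGLn.lean` docstrings]; ceiling_lift = L-arithmeticity (and Galois
  representations) for IRREGULAR L-algebraic `π` = the declared residual TOR_res′ (α′) — none claimed.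

## Differs by construction (bus ≤ L2610)

From lens-4's own g29 (`TwinRigiditySplitRegular`: regular cut of the LAYER-FREE twin statement, decided by lang.S27 alone): here the cut is on the perfect-layer residual
and the load-bearing wall is CLOZEL'S ARITHMETICITY feeding g36's Galois-representation-free torus pricing over NON-accessible `K` — lang.S27 only clears the accessible
sector.  From g36 (new dial, print population): g37 PROVES the population.  No other lens works on TOR_res / TOR° (lens-1 g37: leaf 12741; lens-2 g37: NMC; lens-3 g32:
FERN lineage; lens-5 g35: RES34/RES35 Mordell–Weil dials; lens-6 g41: leaf 27276).

## Landing (census twin, `--supports stmt-Langlands-27355 --as helper`)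

Two modules, pre-cut in `landing/`: `Theorems/ArithmeticDialSplitHeart.lean` (module 1, imports ONLY tree modules: the regular-sector file of IrreducibilityBySelfDuality,
`Literature.NumberTheory.Automorphic.ClozelCArithmetic`, `HarnessLib`; checkable NOW, check json in the kit) then `Theorems/ArithmeticDialSplit.lean` (module 2, imports
module 1 + tree `Theorems.TorusPricingSplit`).  The CHECK FORM `ArithmeticDialSplit.lean` (this file when read from the kit root) is module 1's body followed by module 2's
body, importing only tree modules — decl-wise identical to the pair.  Bookkeeping one-liners are INLINED as local `have`s (census hygiene after g36's `dedup.landed` bounces).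
[cite: Clozel1990, Thm. 3.13] [cite: Patrikis2019, Thm. 3.2.1] [cite: BockleHui2025, §3.1] [cite: BuzzardGeeLMS2014, Def. 3.1.3, Conj. 3.1.5, §5.3]
[cite: HarrisLanTaylorThorneRMS2016, Thm. A]
-/

set_option linter.dupNamespace false
set_option linter.style.longLine false

noncomputable section

namespace Summit.Langlands.Langlands.Theorems.ArithmeticDialSplit

open scoped BigOperators Topology Matrix Classical NumberField Polynomial
open Filter Set Function
open Literature.NumberTheory.GaloisRepresentations Literature.NumberTheory.Automorphic
open IsDedekindDomain
open Summit.Langlands.Langlands.Theses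
open Summit.Langlands.Langlands.Theorems.TatePhantomLift (PerfectLayerRigidity)
open Summit.Langlands.Langlands.Theorems.PhaseTwistSplit (ImprimitiveCandidateRigidity PowerAvatarDescent imp_of_rigid imp_of_langlands)
open Summit.Langlands.Langlands.Theorems.AdjointCellSplit (QuadIrreducible DihedralCandidateDescent TwistedPrimitiveDescent
  HigherRankImprimitiveRigidity dcd_of_imp)
open Summit.Langlands.Langlands.Theorems.PhaseMomentSplit (PhaseMomentCertificate CertifiedDihedralDescent UncertifiedDihedralDescent dcdres_of_dcd dcdres_of_imp)
open Summit.Langlands.Langlands.Theorems.DeterminantLockSplit (LockedPhaseMomentCertificate LockCertifiedDihedralDescent LockUncertifiedDihedralDescent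
  lockres_of_dcdres lockres_of_dcd lockres_of_imp lock0_of_imp)
open Summit.Langlands.Langlands.Theorems.TorusPricingSplit (TorusPhaseCertificate TorusCertifiedDihedralDescent TorusUncertifiedDihedralDescent
  tor0_of_imp tor0_of_rigid torres_of_imp torres_of_lockres torres_of_rigid)
open Summit.Langlands.Langlands.Theorems.ReciprocityUpToIrreducibility (exists_galoisRep_of_isLAlgebraic_of_isRegular)

/-! ## §2 The pieces (RTOR / TOR_res′ = tree texts of TOR° `7f537f02c8ac` / TOR_res `4660359b645a` with literal, asserted edits; RACC hand-written — `gen_node37.py`) -/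

/-- [new] **RACC · `RegularAccessibleAvatar`** (DECIDED modulo the named fact lang.S27 = `exists_galoisRep_of_regularAlgebraic`
(Harris–Lan–Taylor–Thorne / Scholze / Varma): `racc_of_h27` below · S-implied: `racc_of_langlands` · the `n = 2`, REGULAR slice of the root
piece Acc = `Theses.RootDecomp1.AccessibleAvatars` (stmt-Langlands-29148) in the `IsTotallyReal ∨ IsCMField` form of lang.S27 — credited to nobody,
typed only so that the kernel `closes_target` is fact-free).  A regular L-algebraic cuspidal `π` on `GL₂` over a totally real or CM field has, for
every `ℓ`, `ι`, a semisimple `ℓ`-adic avatar Satake–Frobenius compatible with `(π, ι)` at almost every place — NO layer, NO candidate, NO certificate.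
Why it might fail: it cannot (tree theorem `exists_galoisRep_of_isLAlgebraic_of_isRegular` modulo lang.S27). [ref: HarrisLanTaylorThorneRMS2016, Thm. A]
[ref: BuzzardGeeLMS2014, Conj. 3.2.2 and §5.3] -/
def RegularAccessibleAvatar : Prop :=
  ∀ (K : Type) [Field K] [NumberField K], (NumberField.IsTotallyReal K ∨ NumberField.IsCMField K) → ∀ (hcpt : Literature.NumberTheory.Automorphic.isCompact_glFiniteIntegralLevel 2 K) (π : Literature.NumberTheory.Automorphic.CuspidalAutomorphicRepData 2 K hcpt), π.1.IsLAlgebraic → (∃ T : Literature.NumberTheory.Automorphic.InfinityType K 2, π.1.HasInfinityType T ∧ T.IsRegular) → ∀ (ℓ : ℕ) [Fact ℓ.Prime] (ι : PadicAlgCl ℓ ≃+* ℂ), ∃ ρ : Literature.NumberTheory.GaloisRepresentations.FramedGaloisRep K (PadicAlgCl ℓ) 2, ρ.toGaloisRep.IsSemisimple ∧ ∀ᶠ v : IsDedekindDomain.HeightOneSpectrum (NumberField.RingOfIntegers K) in Filter.cofinite, SatakeFrobCompatibleAt ι π.1 ρ v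

/-- [new] **RTOR · `RegularTorusDihedralDescent`** (crux-shaped piece · STRONG-ARTIN-FREE, GALOIS-REPRESENTATION-FREE · WEAKER than IMP and than RIGID =
stmt-Langlands-27355: `rtor_of_imp`, `rtor_of_rigid` · S-implied: `rtor_of_langlands` · **IMPLIED BY g36's certified piece TOR° modulo Clozel's named fact:
`rtor_of_tor0 (hC : Clozel1990_cArithmetic) : TorusCertifiedDihedralDescent → RegularTorusDihedralDescent`** (module 1's
`isLArithmetic_of_isLAlgebraic_of_isRegular`) — so it is NO new burden: TOR°'s paper proof (a‴) + Clozel Thm. 3.13 decide it, over EVERY number field `K`,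
including the mixed-signature fields where no Galois representation of `π` is known to exist).  TOR°'s tree text with the antecedent
`(∃ E : Subfield ℂ, … ∈ E) →` (= `π.1.IsLArithmetic` unfolded) REPLACED by `(∃ T : InfinityType K 2, π.1.HasInfinityType T ∧ T.IsRegular) →`.
Why it might fail: it cannot if Langlands holds (`rtor_of_langlands`); as a stand-alone claim it is exactly as safe as TOR° (g36 flag 1: Lean debt of (a‴)). -/
def RegularTorusDihedralDescent : Prop :=
  ∀ (K : Type) [Field K] [NumberField K] (hcpt : Literature.NumberTheory.Automorphic.isCompact_glFiniteIntegralLevel 2 K) (π : Literature.NumberTheory.Automorphic.CuspidalAutomorphicRepData 2 K hcpt), π.1.IsLAlgebraic → ∀ (L : Type) [Field L] [NumberField L] [Algebra K L], IsGalois K L → Module.finrank K L ≠ 1 → (¬ ∃ F : IntermediateField K L, F ≠ ⊥ ∧ IsGalois K ↥F ∧ IsCyclic (↥F ≃ₐ[K] ↥F) ∧ (Module.finrank K ↥F).Prime) → ∀ (ℓ : ℕ) [Fact ℓ.Prime] (ι : PadicAlgCl ℓ ≃+* ℂ) (r : Literature.NumberTheory.GaloisRepresentations.FramedGaloisRep L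 (PadicAlgCl ℓ) 2), r.toGaloisRep.IsSemisimple → r.IsIrreducible → (∃ T : Literature.NumberTheory.Automorphic.InfinityType K 2, π.1.HasInfinityType T ∧ T.IsRegular) → TorusPhaseCertificate (L ≃ₐ[K] L) → (∃ ρ₀ : Literature.NumberTheory.GaloisRepresentations.FramedGaloisRep K (PadicAlgCl ℓ) 2, ρ₀.toGaloisRep.IsSemisimple ∧ ¬ QuadIrreducible K ρ₀ ∧ (∀ᶠ w : IsDedekindDomain.HeightOneSpectrum (NumberField.RingOfIntegers L) in cofinite, ∀ (v : IsDedekindDomain.HeightOneSpectrum (NumberField.RingOfIntegers K)) (α : Multiset ℂ), w.asIdeal.under (NumberField.RingOfIntegers K) = v.asIdeal → π.1.HasSatakeParamAt v α → (ρ₀.restrictField L).IsUnramifiedAt w ∧ (ρ₀.restrictField L).HasFrobCharpolyAt w (Literature.NumberTheory.Automorphic.arithFrobPolyOfSatake ι w.residueCard 1 (α.map (fun a => a ^ w.asIdeal.inertiaDeg (NumberField.RingOfIntegers K)))))) → (∀ᶠ w : IsDedekindDomain.HeightOneSpectrum (NumberField.RingOfIntegers L) in cofinite, ∀ (v : IsDedekindDomain.HeightOneSpectrum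 (NumberField.RingOfIntegers K)) (α : Multiset ℂ), w.asIdeal.under (NumberField.RingOfIntegers K) = v.asIdeal → π.1.HasSatakeParamAt v α → r.IsUnramifiedAt w ∧ r.HasFrobCharpolyAt w (Literature.NumberTheory.Automorphic.arithFrobPolyOfSatake ι w.residueCard 1 (α.map (fun a => a ^ w.asIdeal.inertiaDeg (NumberField.RingOfIntegers K))))) → ∃ ρ : Literature.NumberTheory.GaloisRepresentations.FramedGaloisRep K (PadicAlgCl ℓ) 2, ρ.toGaloisRep.IsSemisimple ∧ ∀ᶠ v : IsDedekindDomain.HeightOneSpectrum (NumberField.RingOfIntegers K) in cofinite, SatakeFrobCompatibleAt ι π.1 ρ v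

/-- [new] **TOR_res′ · `IrregularUncertifiedDihedralDescent`** (declared RESIDUAL after g37 · WEAKER than g36's residual TOR_res: `torres'_of_torres` — THE
RESIDUAL SHRANK · weaker than LOCK_res, DCD_res, DCD, IMP, RIGID · S-implied · conversely `closes_target_of_facts`: modulo lang.S27 and Clozel 3.13, TOR° ∧ TOR_res′
⟹ TOR_res, i.e. THIS is now the residual of the lineage).  TOR_res's tree text VERBATIM with the single antecedent
`¬ ((∃ T : InfinityType K 2, π.1.HasInfinityType T ∧ T.IsRegular) ∧ ((NumberField.IsTotallyReal K ∨ NumberField.IsCMField K) ∨ TorusPhaseCertificate (L ≃ₐ[K] L))) →`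
inserted after `¬ ((∃ E, …) ∧ TorusPhaseCertificate (L ≃ₐ[K] L)) →`.  What is left — THE CORNER (lens 4): every configuration still dark has
(α′) `π∞` IRREGULAR at some archimedean place (Maaß type / weight one: `HasInfinityType T` with `T.a σ` a repeated multiset) — on every lock-silent layer, over every `K`; or
(β′) `π` regular but `K` of MIXED SIGNATURE (neither totally real nor CM: no Shimura variety, lang.S27 silent) AND the layer group torus-silent (and lock- and
adjoint-cell-silent as before: `6·A₆`, `SL₂(𝔽₁₃)`, `SL₂(𝔽₁₇)`, `2·A₇`, … by instrument I-g36.1).  The accessible-regular sector is GONE for every layer group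
(silent or not), the regular torus-certified sector is GONE over every `K`. -/
def IrregularUncertifiedDihedralDescent : Prop :=
  ∀ (K : Type) [Field K] [NumberField K] (hcpt : Literature.NumberTheory.Automorphic.isCompact_glFiniteIntegralLevel 2 K) (π : Literature.NumberTheory.Automorphic.CuspidalAutomorphicRepData 2 K hcpt), π.1.IsLAlgebraic → ∀ (L : Type) [Field L] [NumberField L] [Algebra K L], IsGalois K L → Module.finrank K L ≠ 1 → (¬ ∃ F : IntermediateField K L, F ≠ ⊥ ∧ IsGalois K ↥F ∧ IsCyclic (↥F ≃ₐ[K] ↥F) ∧ (Module.finrank K ↥F).Prime) → ∀ (ℓ : ℕ) [Fact ℓ.Prime] (ι : PadicAlgCl ℓ ≃+* ℂ) (r : Literature.NumberTheory.GaloisRepresentations.FramedGaloisRep L (PadicAlgCl ℓ) 2), r.toGaloisRep.IsSemisimple → r.IsIrreducible → ¬ PhaseMomentCertificate (L ≃ₐ[K] L) → ¬ LockedPhaseMomentCertificate (L ≃ₐ[K] L) → ¬ ((∃ E : Subfield ℂ, FiniteDimensional ℚ ↥E ∧ ∀ᶠ v : IsDedekindDomain.HeightOneSpectrum (NumberField.RingOfIntegers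 K) in Filter.cofinite, ∀ α : Multiset ℂ, π.1.HasSatakeParamAt v α → ∀ k : ℕ, ((α.map fun a => (Polynomial.X - Polynomial.C a : Polynomial ℂ)).prod).coeff k ∈ E) ∧ TorusPhaseCertificate (L ≃ₐ[K] L)) → ¬ ((∃ T : Literature.NumberTheory.Automorphic.InfinityType K 2, π.1.HasInfinityType T ∧ T.IsRegular) ∧ ((NumberField.IsTotallyReal K ∨ NumberField.IsCMField K) ∨ TorusPhaseCertificate (L ≃ₐ[K] L))) → Summit.Langlands.Langlands.Theorems.RegularShadowSplit.StrongArtinOver K → (∃ ρ₀ : Literature.NumberTheory.GaloisRepresentations.FramedGaloisRep K (PadicAlgCl ℓ) 2, ρ₀.toGaloisRep.IsSemisimple ∧ ¬ QuadIrreducible K ρ₀ ∧ (∀ᶠ w : IsDedekindDomain.HeightOneSpectrum (NumberField.RingOfIntegers L) in cofinite, ∀ (v : IsDedekindDomain.HeightOneSpectrum (NumberField.RingOfIntegers K)) (α : Multiset ℂ), w.asIdeal.under (NumberField.RingOfIntegers K) = v.asIdeal → π.1.HasSatakeParamAt v α → (ρ₀.restrictField L).IsUnramifiedAt w ∧ (ρ₀.restrictField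 L).HasFrobCharpolyAt w (Literature.NumberTheory.Automorphic.arithFrobPolyOfSatake ι w.residueCard 1 (α.map (fun a => a ^ w.asIdeal.inertiaDeg (NumberField.RingOfIntegers K)))))) → (∀ᶠ w : IsDedekindDomain.HeightOneSpectrum (NumberField.RingOfIntegers L) in cofinite, ∀ (v : IsDedekindDomain.HeightOneSpectrum (NumberField.RingOfIntegers K)) (α : Multiset ℂ), w.asIdeal.under (NumberField.RingOfIntegers K) = v.asIdeal → π.1.HasSatakeParamAt v α → r.IsUnramifiedAt w ∧ r.HasFrobCharpolyAt w (Literature.NumberTheory.Automorphic.arithFrobPolyOfSatake ι w.residueCard 1 (α.map (fun a => a ^ w.asIdeal.inertiaDeg (NumberField.RingOfIntegers K))))) → ∃ ρ : Literature.NumberTheory.GaloisRepresentations.FramedGaloisRep K (PadicAlgCl ℓ) 2, ρ.toGaloisRep.IsSemisimple ∧ ∀ᶠ v : IsDedekindDomain.HeightOneSpectrum (NumberField.RingOfIntegers K) in cofinite, SatakeFrobCompatibleAt ι π.1 ρ v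

/-! ## §3 Kernel: `closes_target` (TOR_res BY NAME, 0 sorry, fact-free), necessity, decision and summit-side certificates -/

/-- **The deciding theorem** (0 sorry, no named fact): RACC → RTOR → TOR_res′ → TOR_res, concluding the tree decl
`Theorems.TorusPricingSplit.TorusUncertifiedDihedralDescent` (g36's declared residual) BY NAME.  Cases on the corner predicate
`regular ∧ (K totally real/CM ∨ TorusPhaseCertificate (Gal(L/K)))`: accessible-regular ⟹ RACC gives the avatar outright (every layer hypothesis, the candidate,
strong Artin and all three `¬ certificate` hypotheses are NOT USED); regular + torus-certified ⟹ RTOR; otherwise the residual. -/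
theorem closes_target (hA : RegularAccessibleAvatar) (hT : RegularTorusDihedralDescent) (hR : IrregularUncertifiedDihedralDescent) :
    TorusUncertifiedDihedralDescent := by
  intro K _ _ hcpt π hπ L _ _ _ hGal h1 hnc ℓ _ ι r hr hirr hnpc hnlc hntc hSA hcand hrel
  by_cases hc : (∃ T : Literature.NumberTheory.Automorphic.InfinityType K 2, π.1.HasInfinityType T ∧ T.IsRegular) ∧ ((NumberField.IsTotallyReal K ∨ NumberField.IsCMField K) ∨ TorusPhaseCertificate (L ≃ₐ[K] L))
  · obtain ⟨hreg, hK | htc⟩ := hc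
    · exact hA K hK hcpt π hπ hreg ℓ ι
    · exact hT K hcpt π hπ L hGal h1 hnc ℓ ι r hr hirr hreg htc hcand hrel
  · exact hR K hcpt π hπ L hGal h1 hnc ℓ ι r hr hirr hnpc hnlc hntc hc hSA hcand hrel

/-- **TOR_res′ is WEAKER than TOR_res** (one inserted antecedent): the declared residual of the lineage SHRINKS again. -/
theorem torres'_of_torres (h : TorusUncertifiedDihedralDescent) : IrregularUncertifiedDihedralDescent := by
  intro K _ _ hcpt π hπ L _ _ _ hGal h1 hnc ℓ _ ι r hr hirr hnpc hnlc hntc _hnreg hSA hcand hrel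
  exact h K hcpt π hπ L hGal h1 hnc ℓ ι r hr hirr hnpc hnlc hntc hSA hcand hrel

/-- TOR_res′ is WEAKER than LOCK_res (g35's residual). -/
theorem torres'_of_lockres (h : LockUncertifiedDihedralDescent) : IrregularUncertifiedDihedralDescent := torres'_of_torres (torres_of_lockres h)

/-- TOR_res′ is WEAKER than IMP (`PhaseTwistSplit.ImprimitiveCandidateRigidity`). -/
theorem torres'_of_imp (h : ImprimitiveCandidateRigidity) : IrregularUncertifiedDihedralDescent := torres'_of_torres (torres_of_imp h)

/-- TOR_res′ is WEAKER than RIGID (stmt-Langlands-27355). -/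
theorem torres'_of_rigid (hR : PerfectLayerRigidity) : IrregularUncertifiedDihedralDescent := torres'_of_torres (torres_of_rigid hR)

/-- **RTOR is WEAKER than IMP** (which carries NO strong-Artin and NO dial antecedent): both dial antecedents are dropped and the dihedral cell is in
particular not strongly irreducible (tree `TorusPricingSplit.tor0_of_imp` pattern). -/
theorem rtor_of_imp (h : ImprimitiveCandidateRigidity) : RegularTorusDihedralDescent := by
  intro K _ _ hcpt π hπ L _ _ _ hGal h1 hnc ℓ _ ι r hr hirr _hreg _hc hcand hrel
  obtain ⟨ρ₀, hρ₀, hq, h₀⟩ := hcand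
  have hnsi : ¬ ∀ (M : Type) [Field M] [NumberField M] [Algebra K M], (ρ₀.restrictField M).IsIrreducible :=
    fun hsi => hq fun M _ _ _ _ => hsi M
  exact h K 2 hcpt two_pos π hπ L hGal h1 hnc ℓ ι r hr hirr ⟨ρ₀, hρ₀, hnsi, h₀⟩ hrel

/-- RTOR is WEAKER than RIGID (stmt-Langlands-27355, tree twin `TatePhantomLift.PerfectLayerRigidity`). -/
theorem rtor_of_rigid (hR : PerfectLayerRigidity) : RegularTorusDihedralDescent := rtor_of_imp (imp_of_rigid hR)

/-- **RTOR ⟸ TOR° modulo Clozel's C-arithmeticity** (module 1): on the regular sector the L-arithmeticity antecedent of g36's certified piece is DISCHARGED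
by `isLArithmetic_of_isLAlgebraic_of_isRegular`, over every number field `K`. [cite: Clozel1990, Thm. 3.13] [cite: BuzzardGeeLMS2014, §5.3] -/
theorem rtor_of_tor0 (hC : Clozel1990_cArithmetic) (h : TorusCertifiedDihedralDescent) : RegularTorusDihedralDescent := by
  intro K _ _ hcpt π hπ L _ _ _ hGal h1 hnc ℓ _ ι r hr hirr hreg htc hcand hrel
  exact h K hcpt π hπ L hGal h1 hnc ℓ ι r hr hirr (isLArithmetic_of_isLAlgebraic_of_isRegular hC hcpt two_pos π hπ hreg) htc hcand hrel

/-- **RACC is DECIDED modulo lang.S27** (`exists_galoisRep_of_regularAlgebraic`): the tree theorem `exists_galoisRep_of_isLAlgebraic_of_isRegular`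
(regular-sector file of route IrreducibilityBySelfDuality) gives a SEMISIMPLE `r` compatible at every good place `v ∤ ℓ`; pass to the cofinite filter
(`hasSatakeParamAt_cofinite_holds`, `Ideal.finite_factors`) exactly as in the tree's `satakeAE_of_regular_of_exists_galoisRep`, keeping semisimplicity.
[cite: HarrisLanTaylorThorneRMS2016, Thm. A] [cite: BuzzardGeeLMS2014, §5.3] -/
theorem racc_of_h27 (h27 : exists_galoisRep_of_regularAlgebraic) : RegularAccessibleAvatar := by
  intro K _ _ hK hcpt π hπ hreg ℓ _ ι
  obtain ⟨r, hrss, hr⟩ := exists_galoisRep_of_isLAlgebraic_of_isRegular h27 hcpt two_pos hK π hπ hreg ℓ ι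
  have hℓ0 : Ideal.span {((ℓ : ℕ) : 𝓞 K)} ≠ ⊥ := by
    rw [Ne, Ideal.span_singleton_eq_bot]
    exact_mod_cast (Fact.out : ℓ.Prime).ne_zero
  have hfin : ∀ᶠ v : HeightOneSpectrum (𝓞 K) in cofinite, ((ℓ : ℕ) : 𝓞 K) ∉ v.asIdeal := by
    rw [Filter.eventually_cofinite]
    refine (Ideal.finite_factors hℓ0).subset fun v hv => ?_
    simp only [Set.mem_setOf_eq, not_not] at hv
    exact Ideal.dvd_span_singleton.mpr hv
  refine ⟨r, hrss, ?_⟩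
  filter_upwards [π.1.hasSatakeParamAt_cofinite_holds, hfin] with v hv hvℓ
  obtain ⟨α, hα⟩ := hv
  exact ⟨α, hα, hr v α hα hvℓ⟩

/-- RACC is S-implied (directly from the ROOT: reciprocity gives an irreducible, hence semisimple, compatible `ρ`; no layer is involved). -/
private theorem racc_of_langlands (hL : _root_.Langlands) : RegularAccessibleAvatar := by
  intro K _ _ _hK hcpt π hπ _hreg ℓ _ ι
  obtain ⟨⟨𝓡⟩, h⟩ := hL K
  obtain ⟨ρ, hirr, -, hcorr, -⟩ := (h 𝓡 2 two_pos hcpt).1 π hπ ℓ ι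
  refine ⟨ρ, ?_, hcorr.1⟩
  haveI := hirr
  change ComplementedLattice _
  infer_instance

/-- RTOR is S-implied. -/
private theorem rtor_of_langlands (hL : _root_.Langlands) : RegularTorusDihedralDescent := rtor_of_imp (imp_of_langlands hL)

/-- TOR_res′ is S-implied. -/
private theorem torres'_of_langlands (hL : _root_.Langlands) : IrregularUncertifiedDihedralDescent := torres'_of_imp (imp_of_langlands hL)

/-- Unconditional half of the exactness: IMP implies RTOR and TOR_res′ (RACC is decided independently, modulo lang.S27). -/
theorem pieces_of_imp (h : ImprimitiveCandidateRigidity) : RegularTorusDihedralDescent ∧ IrregularUncertifiedDihedralDescent :=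
  ⟨rtor_of_imp h, torres'_of_imp h⟩

/-- **THE NET STATEMENT (modulo the two named facts lang.S27 and Clozel 3.13): g36's certified piece and the NEW residual recover g36's residual** —
`TOR° → TOR_res′ → TOR_res`; i.e. the residual of the lineage is now TOR_res′ = `IrregularUncertifiedDihedralDescent`. -/
theorem closes_target_of_facts (h27 : exists_galoisRep_of_regularAlgebraic) (hC : Clozel1990_cArithmetic)
    (h0 : TorusCertifiedDihedralDescent) (hR : IrregularUncertifiedDihedralDescent) : TorusUncertifiedDihedralDescent :=
  closes_target (racc_of_h27 h27) (rtor_of_tor0 hC h0) hR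

/-! ## §4 Host edges (BY NAME, through the tree kernels g36 `TorusPricingSplit.closes_*` → g35 → g34 → g33 → g30) -/

/-- LOCK_res (g35's residual `DeterminantLockSplit.LockUncertifiedDihedralDescent`) ⟸ TOR° ∧ RACC ∧ RTOR ∧ TOR_res′. -/
theorem closes_lockres (h0 : TorusCertifiedDihedralDescent) (hA : RegularAccessibleAvatar) (hT : RegularTorusDihedralDescent)
    (hR : IrregularUncertifiedDihedralDescent) : LockUncertifiedDihedralDescent :=
  TorusPricingSplit.closes_target h0 (closes_target hA hT hR)

/-- DCD (`AdjointCellSplit.DihedralCandidateDescent`) ⟸ LOCK° ∧ TOR° ∧ RACC ∧ RTOR ∧ TOR_res′. -/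
theorem closes_dcd (hL : LockCertifiedDihedralDescent) (h0 : TorusCertifiedDihedralDescent) (hA : RegularAccessibleAvatar)
    (hT : RegularTorusDihedralDescent) (hR : IrregularUncertifiedDihedralDescent) : DihedralCandidateDescent :=
  TorusPricingSplit.closes_dcd hL h0 (closes_target hA hT hR)

/-- The live ledger item stmt-Langlands-27355 `Theses.PerfectLayerClifford.PerfectLayerRigidity` BY NAME ⟸ PAR ∧ LOCK° ∧ TOR° ∧ RACC ∧ RTOR ∧ TOR_res′ ∧ TPD ∧ SART ∧ IMP₃. -/
theorem closes_item (hP : PowerAvatarDescent) (hL : LockCertifiedDihedralDescent) (h0 : TorusCertifiedDihedralDescent) (hA : RegularAccessibleAvatar)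
    (hT : RegularTorusDihedralDescent) (hR : IrregularUncertifiedDihedralDescent) (hD : TwistedPrimitiveDescent) (hS : MonomialConverse.StrongArtinAE)
    (hI : HigherRankImprimitiveRigidity) : Summit.Langlands.Langlands.Theses.PerfectLayerClifford.PerfectLayerRigidity :=
  TorusPricingSplit.closes_item hP hL h0 (closes_target hA hT hR) hD hS hI

/-- The same item modulo the two named facts, WITHOUT RACC and with g36's TOR° doing RTOR's work: PAR ∧ LOCK° ∧ TOR° ∧ TOR_res′ ∧ TPD ∧ SART ∧ IMP₃. -/
theorem closes_item_of_facts (h27 : exists_galoisRep_of_regularAlgebraic) (hC : Clozel1990_cArithmetic) (hP : PowerAvatarDescent)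
    (hL : LockCertifiedDihedralDescent) (h0 : TorusCertifiedDihedralDescent) (hR : IrregularUncertifiedDihedralDescent) (hD : TwistedPrimitiveDescent)
    (hS : MonomialConverse.StrongArtinAE) (hI : HigherRankImprimitiveRigidity) : Summit.Langlands.Langlands.Theses.PerfectLayerClifford.PerfectLayerRigidity :=
  TorusPricingSplit.closes_item hP hL h0 (closes_target_of_facts h27 hC h0 hR) hD hS hI

/-- With the route's other items EXT (27354), FINTYPE (27356), RED° (27357): the host leaf `GaloisHullLift.PerfectHullDescent` (28225) through the ROUTE'S OWN
deciding theorem (tree `TorusPricingSplit.closes_route` → … → `AdjointCellSplit.closes_route`). -/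
theorem closes_route (hE : Summit.Langlands.Langlands.Theses.PerfectLayerClifford.PerfectLayerExtension) (hP : PowerAvatarDescent)
    (hL : LockCertifiedDihedralDescent) (h0 : TorusCertifiedDihedralDescent) (hA : RegularAccessibleAvatar) (hT : RegularTorusDihedralDescent)
    (hR : IrregularUncertifiedDihedralDescent) (hD : TwistedPrimitiveDescent) (hS : MonomialConverse.StrongArtinAE) (hI : HigherRankImprimitiveRigidity)
    (hF : Summit.Langlands.Langlands.Theses.PerfectLayerClifford.FiniteTypePerfectDescent)
    (hRed : Summit.Langlands.Langlands.Theses.PerfectLayerClifford.ReduciblePerfectDescent) : GaloisHullLift.PerfectHullDescent :=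
  TorusPricingSplit.closes_route hE hP hL h0 (closes_target hA hT hR) hD hS hI hF hRed

end Summit.Langlands.Langlands.Theorems.ArithmeticDialSplit

end
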